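import Summits.BirchSwinnertonDyer.Rank1Residual.Additive.TwistedOrdinaryLineOfTwist
import Summits.BirchSwinnertonDyer.Rank1Residual.Partition.EisensteinKernelReductionLine
import Literature.NumberTheory.EllipticCurves.SerreOpenImageOfLocalInputProofs
import HarnessLib

/-!
# Every rational `p`-line of the additive twist `E = V ⊗ χ_{p*}` is RAMIFIED at `p` (`p ≥ 5`):
# the per-pair binder `hram0 : ¬ LineUnramifiedAt W p Φ₀` of the X3♯(G-ord, `e = 2`) end states at
# `p ≥ 5` is a THEOREM (cell `bsd-addord`, seat `bsd-addord-twist`, strategy = twist transport)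

HONEST FRAMING (cell `bsd-addord`, `run/shared/lean/pub/bsd-addord/README.md` §4): the programme's
target of record is the full Birch–Swinnerton-Dyer formula for every `E/ℚ` of analytic rank `≤ 1`;
this file is a KERNEL transport lemma about the Galois module `E[p]` of an additive quadratic twist.
It books nothing, moves no mark, asserts nothing about any curve's BSD formula. THEOREMS ONLY: no
definition, no named fact, no `sorry`.

## What and why

The `p ≥ 5` end states of the X3♯(G-ord, `e = 2`) rows — rank `0`
(`ClassX3Gord.missingLowerBoundAt_rankZero_of_facts_of_nonAnomalous`, p401882;
`ClassX3Gord.missingLowerBoundAt_rankZero_of_facts_intrinsic`, p404507) and rank `1`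
(`TwistedBranchPAdicGrossZagierEndState{,Intrinsic}`, `DisegniLineEndState{,Odd}`), and the route
vocabulary `CaseOneDatum` of `Additive/X3CaseOneMember.lean` (K1) — take a per-pair LINE DATUM
`(Φ₀, hΦ, hram0, heven, hram)`: a rational `p`-line `Φ₀ ≤ E[p]` (`IsRationalLine`), RAMIFIED at `p`
(`hram0 : ¬ LineUnramifiedAt W p Φ₀`), even, whose `χ_{p*}`-twist is ramified. The planner's
second line-datum engine (`HOME/proof/phi0-p5/README.md`) certifies `hΦ`, `heven`, `hram` per row and
records `hram0` as «automatic at `p ≥ 5`: STATED, NOT COMPUTED». This file PROVES it, for EVERY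
rational `p`-line, from the structure of `V[p]` at `p` alone:

* §1 **`not_lineUnramifiedAt_of_twist_model_of_unramifiedQuotientLineAt`** (abstract form). Let
  `W = C • V^{(p*)}` (`p* = (−1)^{⌊p/2⌋} p`, `p ≥ 5`), `𝔓` a prime of `\bar ℤ` above `p`, and suppose
  `V[p]` has an UNRAMIFIED-QUOTIENT line `X` at `I_𝔓` (`UnramifiedQuotientLineAt V p I_𝔓`:
  `(σ − 1)V[p] ⊆ X` for `σ ∈ I_𝔓` — Serre's ordinary line at a good ordinary `p`, the Tate line at a
  multiplicative `p`). Then NO rational `p`-line `Φ₀ ≤ W[p]` is unramified at `p`. Proof (twist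
  transport): along the sign-equivariant `e : W[p] ≃ V[p]` (`e(σT) = χ_{p*}(σ) σ e(T)`, Silverman
  *AEC* X.5.4, tree `exists_signEquiv_of_twist`) an `I_𝔓`-FIXED point `P ∈ Φ₀` goes to `Q = e P`
  with `σQ = χ_{p*}(σ) Q = ±Q` for `σ ∈ I_𝔓`. If `Q ∈ X`: `I_𝔓` acts on `X` through `χ̄_p`
  (tree `smul_eq_cyclotomic_zsmul_of_forall_sub_mem`, Serre §1.11) and some `τ ∈ I_𝔓` has
  `χ̄_p(τ) = 2` (tree `exists_mem_inertia_modNCyclotomicCharacter_eq`), so `2Q = ±Q`, i.e. `Q = 0`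
  or `3Q = 0 = pQ` — impossible for `p ≥ 5`, `Q ≠ 0`. If `Q ∉ X`: a Kummer inertia element `σ₀`
  with `σ₀√p* = −√p*` (`ord_p(p*) = 1`; tree `exists_mem_inertia_smul_geomSqrt_eq_neg`) gives
  `σ₀Q − Q = −2Q ∈ X`, so `Q ∈ X` — contradiction. (At `p = 3` the argument fails exactly as it
  should: `χ_{−3}·χ̄₃ = ω² = 1` on `I_𝔓`, and indeed the `p = 3` twisted-ordinary line of
  `TwistedOrdinaryLineOfTwist.lean` IS inertia-fixed; hence `5 ≤ p`.)
* §2 The cell's rows. (G-ord, `e = 2`): **`not_lineUnramifiedAt_of_goodOrd_pStar_twist`** (`V`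
  globally minimal, good ordinary at `p ≥ 5`, `C • V^{(p*)} = W`; Serre's line from
  `unramifiedQuotientLineAt_of_goodOrdinary`) and the class forms
  **`TypeGOrd.not_lineUnramifiedAt`**, **`ClassX3Gord.not_lineUnramifiedAt`** (`TypeGOrd W p`, additive,
  `semistabilityIndex W p = 2`, `p ≥ 5`: the twist model from `TypeGOrd.exists_goodOrd_pStar_twist_model`)
  — NO fact, NO per-pair datum. (M): **`not_lineUnramifiedAt_of_mult_pStar_twist`** (`V` multiplicative
  at `p ≥ 5`; the Tate line from `exists_unramifiedQuotientLineAt_of_multiplicative`, granted the Tate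
  uniformisation facts A40/A41 `hT`, `hT'` as everywhere in the cell).
* §3 Consequence for the line datum: at `p ≥ 5` a ramified rational line has a point MOVED by some
  `σ ∈ Γ_ℚ` (`exists_smul_ne_of_not_lineUnramifiedAt`), so on these rows the `p = 3`-style binder
  `hnt` is free as well (`ClassX3Gord.exists_smul_ne_of_isRationalLine`).
* §4 (appended) POINTWISE form `TypeGOrd.eq_zero_of_forall_inertia_smul_eq`: `E[p]` has no non-zero
  point fixed by an inertia group above `p` (the §1 proof uses only the fixed point, not the line).

So on every X3♯(G-ord, `e = 2`) row at `p ≥ 5` the binder `hram0` of the end states is discharged by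
`ClassX3Gord.not_lineUnramifiedAt hX hp5 he hΦ` (binder diff `{hram0} ↦ {}`; the hram0-free doors are
in the sequel `X3BranchGordEndStateRamifiedLine.lean`); the datum left per pair is (line, even,
`χ_{p*}`-twist ramified) — the three columns engine 2 certifies.

References: J.-P. Serre, Invent. Math. 15 (1972) §1.11 Prop. 11 and Cor. (the ordinary line; `χ̄_p`
on the canonical subgroup; inertia surjects onto `𝔽_pˣ`) [Serre1972]; J. H. Silverman, *AEC* 2nd ed.
X.5 Cor. 5.4 (quadratic twist), *ATAEC* V.5.3–5.4 (Tate line) [SilvermanAEC2009, SilvermanATAEC1994];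
S. Lang, *Fundamentals of Diophantine Geometry* Ch. 6 Prop. 1.3 (Kummer) [Lang1983]; R. Greenberg,
V. Vatsal, Invent. Math. 142 (2000) Thm. (1.3) ("ramified at `p`") [GreenbergVatsal2000];
HOME/proof/phi0-p5/README.md (dictionary line «hram0 automatic at p ≥ 5»).
-/

set_option autoImplicit false

noncomputable section

open scoped Classical NumberField

open WeierstrassCurve Literature.NumberTheory.EllipticCurves Literature.NumberTheory.GaloisRepresentations
  Field IsDedekindDomain NumberField Rat.HeightOneSpectrum
  Literature.NumberTheory.EllipticCurves.Rank1Residual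
  Summit.BirchSwinnertonDyer.Rank1Residual.GaloisImage
  Summit.BirchSwinnertonDyer.Rank1Residual.Additive.MixedCongruence

namespace Summit.BirchSwinnertonDyer.Rank1Residual.Additive.RationalLineTwist

variable {W : WeierstrassCurve ℚ} {p : ℕ} [Fact p.Prime]

/-! ## §0 Elementary lemmas on `E[p]` -/

/-- `2 ≠ 0` in `𝔽_p` for an odd prime `p`. [folklore] -/
theorem two_intCast_zmod_ne_zero (hp2 : p ≠ 2) : ((2 : ℤ) : ZMod p) ≠ 0 := by
  have hp : p.Prime := Fact.out
  intro h
  have hdvd : (p : ℤ) ∣ 2 := (ZMod.intCast_zmod_eq_zero_iff_dvd 2 p).mp h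
  have hdvd' : p ∣ 2 := Int.natCast_dvd_natCast.mp hdvd
  have hle : p ≤ 2 := Nat.le_of_dvd two_pos hdvd'
  have h2 := hp.two_le
  omega

/-- On `E[p]` with `p ≠ 3`: `2 • Q = Q` or `2 • Q = −Q` forces `Q = 0` (`Q = 0`, resp. `3Q = 0 = pQ`
with `gcd(3, p) = 1`). [folklore] -/
theorem eq_zero_of_two_zsmul_eq_or (hp3 : p ≠ 3) {Q : geomTorsion W (p : ℤ)}
    (h : (2 : ℤ) • Q = Q ∨ (2 : ℤ) • Q = -Q) : Q = 0 := by
  have hp : p.Prime := Fact.out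
  rcases h with h | h
  · rw [two_zsmul] at h
    have h' : Q + Q = Q + 0 := by rw [add_zero]; exact h
    exact add_left_cancel h'
  · have h3 : (3 : ℤ) • Q = 0 := by
      rw [show (3 : ℤ) = 2 + 1 by norm_num, add_zsmul, one_zsmul, h, neg_add_cancel]
    have hpQ : (p : ℤ) • Q = 0 := natCast_zsmul_eq_zero Q
    have hcop : IsCoprime (3 : ℤ) (p : ℤ) := by
      have h3p : Nat.Coprime 3 p := (Nat.coprime_primes Nat.prime_three hp).mpr (Ne.symm hp3)
      exact_mod_cast Nat.isCoprime_iff_coprime.mpr h3p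
    exact KernelDisc.eq_zero_of_zsmul_eq_zero_of_isCoprime h3 hpQ hcop

/-- A rational `p`-line has a non-zero point (`#Φ₀ = p > 1`). [folklore] -/
theorem exists_mem_ne_zero_of_isRationalLine {Φ₀ : AddSubgroup (geomTorsion W (p : ℤ))}
    (hΦ : IsRationalLine W p Φ₀) : ∃ P ∈ Φ₀, P ≠ 0 := by
  have hp : p.Prime := Fact.out
  have hbot : Φ₀ ≠ ⊥ := by
    intro h
    have h1 : Nat.card Φ₀ = 1 := by rw [h]; exact AddSubgroup.card_bot
    exact hp.one_lt.ne' (hΦ.1.symm.trans h1)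
  obtain ⟨⟨P, hP⟩, hP0⟩ := (AddSubgroup.ne_bot_iff_exists_ne_zero).mp hbot
  exact ⟨P, hP, fun h ↦ hP0 (Subtype.ext h)⟩

/-! ## §1 The abstract transport: no rational `p`-line of `C • V^{(p*)}` is unramified at `p` when
`V[p]` has an unramified-quotient line at a prime above `p` (`p ≥ 5`) -/

/-- **Every rational `p`-line of the `p*`-twist is ramified at `p` (`p ≥ 5`; abstract form).** Let
`W = C • V^{(p*)}` be a model of the quadratic twist of `V` by `p* = (−1)^{⌊p/2⌋} p`, `𝔓` a prime of
`\bar ℤ` above `p`, and `V[p]` of unramified-quotient shape at `I_𝔓` (a line `X` with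
`(σ − 1)V[p] ⊆ X` for `σ ∈ I_𝔓`). Then no rational `p`-line `Φ₀ ≤ W[p]` is fixed pointwise by the
inertia groups above `p`. Twist transport along the sign-equivariant `W[p] ≃ V[p]`
(Silverman X.5.4): an inertia-fixed `P ∈ Φ₀` maps to `Q` with `σQ = ±Q` on `I_𝔓`; on `X` inertia
acts through `χ̄_p` which takes the value `2 ≢ ±1 (mod p)`; off `X` the Kummer element flipping `√p*`
gives `2Q ∈ X`. [cite: Serre1972, §1.11 Prop. 11 and Cor.] [cite: SilvermanAEC2009, X.5 Cor. 5.4]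
[cite: Lang1983, Ch. 6 Prop. 1.3] -/
theorem not_lineUnramifiedAt_of_twist_model_of_unramifiedQuotientLineAt
    {V : WeierstrassCurve ℚ} [V.IsElliptic] (hp5 : 5 ≤ p) (C : VariableChange ℚ)
    (hC : C • V.quadraticTwist ((-1 : ℚ) ^ (p / 2) * p) = W)
    {v : HeightOneSpectrum (𝓞 ℚ)} (hv : ((p : ℕ) : 𝓞 ℚ) ∈ v.asIdeal)
    {𝔓 : Ideal (absIntegers (𝓞 ℚ) ℚ)} (h𝔓 : 𝔓 ∈ v.primesAbove)
    (hA : UnramifiedQuotientLineAt V p (𝔓.inertia (absoluteGaloisGroup ℚ)))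
    {Φ₀ : AddSubgroup (geomTorsion W (p : ℤ))} (hΦ : IsRationalLine W p Φ₀) :
    ¬ LineUnramifiedAt W p Φ₀ := by
  intro hunr
  have hp : p.Prime := Fact.out
  have hp2 : p ≠ 2 := by omega
  have hp3 : p ≠ 3 := by omega
  haveI : NeZero p := ⟨hp.ne_zero⟩
  set d : ℚ := (-1 : ℚ) ^ (p / 2) * p with hd
  have hd0 : d ≠ 0 := Additive.pStar_ne_zero p
  -- the sign-equivariant identification `e : W[p] ≃ V[p]`
  have hC' : C⁻¹ • W = V.quadraticTwist d := by rw [← hC, inv_smul_smul]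
  obtain ⟨e, hpos, hneg⟩ := exists_signEquiv_of_twist (W := V) (Wd := W) (p := p) hd0 C⁻¹ hC'
  -- Serre's / Tate's line of `V` at `𝔓`
  obtain ⟨X, hX, hXsub⟩ := hA
  -- a non-zero point of `Φ₀`, fixed by `I_𝔓`, and its image `Q`
  obtain ⟨P, hPΦ, hP0⟩ := exists_mem_ne_zero_of_isRationalLine hΦ
  have hfix : ∀ σ ∈ 𝔓.inertia (absoluteGaloisGroup ℚ), σ • P = P :=
    fun σ hσ ↦ hunr v hv 𝔓 h𝔓 σ hσ P hPΦ
  set Q : geomTorsion V (p : ℤ) := e P with hQ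
  have hQ0 : Q ≠ 0 := fun h ↦ hP0 (e.injective (h.trans (map_zero e).symm))
  -- `I_𝔓` acts on `Q` by the sign `χ_{p*}`
  have hsame : ∀ σ ∈ 𝔓.inertia (absoluteGaloisGroup ℚ), σ • geomSqrt d = geomSqrt d → σ • Q = Q := by
    intro σ hσ hs
    have h := hpos σ hs P
    rw [hfix σ hσ] at h
    exact h.symm
  have hflip : ∀ σ ∈ 𝔓.inertia (absoluteGaloisGroup ℚ), ¬ σ • geomSqrt d = geomSqrt d →
      σ • Q = -Q := by
    intro σ hσ hs
    have h := hneg σ hs P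
    rw [hfix σ hσ] at h
    -- `h : Q = -(σ • Q)`
    have h' := congrArg Neg.neg h
    rw [neg_neg] at h'
    exact h'.symm
  -- (a) an inertia element `τ` with `χ̄_p(τ) = 2`
  have hvgen : Rat.HeightOneSpectrum.natGenerator v = p := Rat.natGenerator_eq_of_prime_mem v hp hv
  have hcop : Nat.Coprime 2 p := (Nat.coprime_primes Nat.prime_two hp).mpr (Ne.symm hp2)
  obtain ⟨τ, hτI, hτa⟩ := exists_mem_inertia_modNCyclotomicCharacter_eq (m := p) (p := p) (k := 0)
    (d := 1) (by rw [zero_add, pow_one, mul_one]) hp.not_dvd_one hvgen h𝔓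
    (a := ZMod.unitOfCoprime 2 hcop) (Subsingleton.elim _ _)
  have hval : ((((modPCyclotomicCharacterZMod ℚ p τ : (ZMod p)ˣ) : ZMod p).val : ℤ)) = 2 := by
    rw [modPCyclotomicCharacterZMod_eq_modNCyclotomicCharacter, hτa, ZMod.coe_unitOfCoprime,
      ZMod.val_natCast, Nat.mod_eq_of_lt (by omega)]
    norm_num
  -- (b) a Kummer inertia element `σ₀` with `σ₀ √p* = -√p*`
  have hγ : v.intValuation (((-1 : ℤ) ^ (p / 2) * p : ℤ) : 𝓞 ℚ) = WithZero.exp (-1 : ℤ) :=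
    intValuation_pStar p hv
  have h2v : (2 : 𝓞 ℚ) ∉ v.asIdeal := two_not_mem_of_natCast_prime_mem hp hp2 hv
  obtain ⟨σ₀, hσ₀I, hσ₀⟩ := exists_mem_inertia_smul_geomSqrt_eq_neg hγ h2v h𝔓
  have hcoe : ((((-1 : ℤ) ^ (p / 2) * p : ℤ) : 𝓞 ℚ) : ℚ) = d := by
    rw [RingOfIntegers.coe_eq_algebraMap, map_intCast, hd]
    push_cast
    rfl
  rw [hcoe] at hσ₀
  have hσ₀' : ¬ σ₀ • geomSqrt d = geomSqrt d := fun h ↦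
    geomSqrt_ne_neg hd0 (h.symm.trans hσ₀)
  -- case split on `Q ∈ X`
  by_cases hQX : Q ∈ X
  · -- on `X`, `τ` acts by `χ̄_p(τ) = 2` and by `±1`
    have hτQ := smul_eq_cyclotomic_zsmul_of_forall_sub_mem V p τ hX (hXsub τ hτI) hQX
    rw [hval] at hτQ
    apply hQ0
    refine eq_zero_of_two_zsmul_eq_or hp3 ?_
    by_cases hs : τ • geomSqrt d = geomSqrt d
    · left; rw [← hτQ]; exact hsame τ hτI hs
    · right; rw [← hτQ]; exact hflip τ hτI hs
  · -- off `X`, the flip `σ₀` gives `-Q - Q ∈ X`, so `2Q ∈ X` and `Q ∈ X`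
    have hmem := hXsub σ₀ hσ₀I Q
    rw [hflip σ₀ hσ₀I hσ₀'] at hmem
    have h2 : (2 : ℤ) • Q ∈ X := by
      have heq : -Q - Q = -((2 : ℤ) • Q) := by rw [two_zsmul, neg_add, sub_eq_add_neg]
      rw [heq] at hmem
      exact (neg_mem_iff).mp hmem
    exact hQX (mem_of_zsmul_mem (two_intCast_zmod_ne_zero hp2) h2)

/-! ## §2 The cell's rows: (G-ord, `e = 2`) unconditionally; (M) modulo Tate uniformisation -/

/-- **(G-ord, `e = 2`), twist-model form.** `V` globally minimal, GOOD ORDINARY at `p ≥ 5`,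
`C • V^{(p*)} = W`: every rational `p`-line of `W` is ramified at `p`. Serre's ordinary line of `V`
at the place's primes (`unramifiedQuotientLineAt_of_goodOrdinary`) + §1. NO fact, NO datum.
[cite: Serre1972, §1.11 Prop. 11 and Cor.] [cite: SilvermanAEC2009, X.5 Cor. 5.4] -/
theorem not_lineUnramifiedAt_of_goodOrd_pStar_twist {V : WeierstrassCurve ℚ} [V.IsElliptic]
    [V.IsGloballyMinimal] (hp5 : 5 ≤ p) (hgood : V.HasGoodReductionAtPrime p)
    (hord : ¬ (p : ℤ) ∣ V.frobeniusTrace p) (C : VariableChange ℚ)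
    (hC : C • V.quadraticTwist ((-1 : ℚ) ^ (p / 2) * p) = W)
    {Φ₀ : AddSubgroup (geomTorsion W (p : ℤ))} (hΦ : IsRationalLine W p Φ₀) :
    ¬ LineUnramifiedAt W p Φ₀ := by
  have hp : p.Prime := Fact.out
  have hp2 : p ≠ 2 := by omega
  set v := (primesEquiv (R := 𝓞 ℚ)).symm ⟨p, hp⟩ with hvdef
  have hvp : (primesEquiv v : ℕ) = p :=
    congrArg Subtype.val ((primesEquiv (R := 𝓞 ℚ)).apply_symm_apply ⟨p, hp⟩)
  have hv : (p : 𝓞 ℚ) ∈ v.asIdeal := KernelDisc.natCast_mem_asIdeal_primesEquiv_symm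
  obtain ⟨𝔓, -, h𝔓⟩ := exists_ideal_placeOver p hvp
  exact not_lineUnramifiedAt_of_twist_model_of_unramifiedQuotientLineAt hp5 C hC hv h𝔓
    (unramifiedQuotientLineAt_of_goodOrdinary hp2 hgood hord hv h𝔓) hΦ

/-- **(G-ord, `e = 2`), class form.** For `W` globally minimal, additive at `p ≥ 5` of type (G)-ordinary
with semistability defect `2` (so `W = C • V^{(p*)}` with `V` good ordinary,
`TypeGOrd.exists_goodOrd_pStar_twist_model`): every rational `p`-line of `W` is ramified at `p`.
[cite: Serre1972, §1.11 Prop. 11 and Cor.] [cite: SilvermanAEC2009, X.5 Cor. 5.4] -/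
theorem TypeGOrd.not_lineUnramifiedAt [W.IsElliptic] [W.IsGloballyMinimal] (hG : TypeGOrd W p)
    (hadd : Addv W p) (hp5 : 5 ≤ p) (he : semistabilityIndex W p = 2)
    {Φ₀ : AddSubgroup (geomTorsion W (p : ℤ))} (hΦ : IsRationalLine W p Φ₀) :
    ¬ LineUnramifiedAt W p Φ₀ := by
  have hp2 : p ≠ 2 := by omega
  obtain ⟨V, _, _, C, hV, hC⟩ := TypeGOrd.exists_goodOrd_pStar_twist_model W p hp2 hG hadd he
  exact not_lineUnramifiedAt_of_goodOrd_pStar_twist hp5 hV.1 hV.2 C hC hΦ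

/-- **X3♯(G-ord) ∩ `I₀*` at `p ≥ 5`: the binder `hram0` of the end states is a theorem.** For
`(E, p) ∈` X3♯(G-ord) (`ClassX3Gord W p`) with `semistabilityIndex W p = 2` and `p ≥ 5`, every
rational `p`-line `Φ₀ ≤ E[p]` is ramified at `p` (`¬ LineUnramifiedAt W p Φ₀`).
[cite: Serre1972, §1.11 Prop. 11 and Cor.] [cite: SilvermanAEC2009, X.5 Cor. 5.4]
[cite: GreenbergVatsal2000, Thm. (1.3)] -/
theorem ClassX3Gord.not_lineUnramifiedAt [W.IsElliptic] [W.IsGloballyMinimal] (hX : ClassX3Gord W p)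
    (hp5 : 5 ≤ p) (he : semistabilityIndex W p = 2)
    {Φ₀ : AddSubgroup (geomTorsion W (p : ℤ))} (hΦ : IsRationalLine W p Φ₀) :
    ¬ LineUnramifiedAt W p Φ₀ :=
  TypeGOrd.not_lineUnramifiedAt hX.typeGOrd hX.addv hp5 he hΦ

/-- **(M), twist-model form (Tate uniformisation A40/A41 granted, as everywhere in the cell).** `V`
globally minimal, MULTIPLICATIVE at `p ≥ 5`, `C • V^{(p*)} = W`: every rational `p`-line of `W` is
ramified at `p`. The Tate line of `V` at the prime chosen by
`exists_unramifiedQuotientLineAt_of_multiplicative` + §1.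
[cite: SilvermanATAEC1994, V.5.3 and V.5.4 (Tate uniformisation)] [cite: SilvermanAEC2009, X.5 Cor. 5.4] -/
theorem not_lineUnramifiedAt_of_mult_pStar_twist {V : WeierstrassCurve ℚ} [V.IsElliptic]
    [V.IsGloballyMinimal]
    (hT : Silverman1994_thmV53_tateUniformisation.{0})
    (hT' : Silverman1994_thmV53_corV54_tateUniformisation.{0})
    (hp5 : 5 ≤ p) (hmult : V.HasMultiplicativeReductionAtPrime p) (C : VariableChange ℚ)
    (hC : C • V.quadraticTwist ((-1 : ℚ) ^ (p / 2) * p) = W)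
    {Φ₀ : AddSubgroup (geomTorsion W (p : ℤ))} (hΦ : IsRationalLine W p Φ₀) :
    ¬ LineUnramifiedAt W p Φ₀ := by
  have hp2 : p ≠ 2 := by omega
  obtain ⟨v, hv, 𝔓, h𝔓, hA⟩ := exists_unramifiedQuotientLineAt_of_multiplicative hT hT' hp2 hmult
  exact not_lineUnramifiedAt_of_twist_model_of_unramifiedQuotientLineAt hp5 C hC hv h𝔓 hA hΦ

/-! ## §3 Ramified lines are moved: the `hnt` binder is free on these rows too -/

omit [Fact p.Prime] in
/-- A line which is not unramified at `p` has a point moved by some `σ ∈ Γ_ℚ` (an inertia element,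
in fact). [folklore] -/
theorem exists_smul_ne_of_not_lineUnramifiedAt [Fact p.Prime] {Φ₀ : AddSubgroup (geomTorsion W (p : ℤ))}
    (h : ¬ LineUnramifiedAt W p Φ₀) :
    ∃ (σ : absoluteGaloisGroup ℚ) (P : geomTorsion W (p : ℤ)), P ∈ Φ₀ ∧ σ • P ≠ P := by
  by_contra hall
  push Not at hall
  exact h fun v _ 𝔓 _ σ _ P hP ↦ hall σ P hP

/-- **X3♯(G-ord) ∩ `I₀*` at `p ≥ 5`: every rational `p`-line carries a non-trivial `Γ_ℚ`-action**
(the `p = 3` end states' binder `hnt`, free here). [cite: Serre1972, §1.11 Prop. 11 and Cor.] -/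
theorem ClassX3Gord.exists_smul_ne_of_isRationalLine [W.IsElliptic] [W.IsGloballyMinimal]
    (hX : ClassX3Gord W p) (hp5 : 5 ≤ p) (he : semistabilityIndex W p = 2)
    {Φ₀ : AddSubgroup (geomTorsion W (p : ℤ))} (hΦ : IsRationalLine W p Φ₀) :
    ∃ (σ : absoluteGaloisGroup ℚ) (P : geomTorsion W (p : ℤ)), P ∈ Φ₀ ∧ σ • P ≠ P :=
  exists_smul_ne_of_not_lineUnramifiedAt (ClassX3Gord.not_lineUnramifiedAt hX hp5 he hΦ)

/-! ## §4 Pointwise form: NO non-zero `p`-torsion point of the twist is fixed by an inertia group above `p`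
(`E[p](ℚ_p^{nr}) = 0` on the (G-ord, `e = 2`) rows at `p ≥ 5`) -/

/-- **No inertia-fixed `p`-torsion on the `p*`-twist (`p ≥ 5`; abstract form).** Same setting as
`not_lineUnramifiedAt_of_twist_model_of_unramifiedQuotientLineAt` (`W = C • V^{(p*)}`, `V[p]` with an
unramified-quotient line `X` at `I_𝔓`): a point `P ∈ W[p]` fixed by every element of `I_𝔓` is `O`. The
proof of §1 verbatim (it uses only that `I_𝔓` fixes `P`). [cite: Serre1972, §1.11 Prop. 11 and Cor.]
[cite: SilvermanAEC2009, X.5 Cor. 5.4] [cite: Lang1983, Ch. 6 Prop. 1.3] -/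
theorem eq_zero_of_forall_inertia_smul_eq_of_twist_model_of_unramifiedQuotientLineAt
    {V : WeierstrassCurve ℚ} [V.IsElliptic] (hp5 : 5 ≤ p) (C : VariableChange ℚ)
    (hC : C • V.quadraticTwist ((-1 : ℚ) ^ (p / 2) * p) = W)
    {v : HeightOneSpectrum (𝓞 ℚ)} (hv : ((p : ℕ) : 𝓞 ℚ) ∈ v.asIdeal)
    {𝔓 : Ideal (absIntegers (𝓞 ℚ) ℚ)} (h𝔓 : 𝔓 ∈ v.primesAbove)
    (hA : UnramifiedQuotientLineAt V p (𝔓.inertia (absoluteGaloisGroup ℚ)))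
    {P : geomTorsion W (p : ℤ)} (hfix : ∀ σ ∈ 𝔓.inertia (absoluteGaloisGroup ℚ), σ • P = P) :
    P = 0 := by
  by_contra hP0
  have hp : p.Prime := Fact.out
  have hp2 : p ≠ 2 := by omega
  have hp3 : p ≠ 3 := by omega
  haveI : NeZero p := ⟨hp.ne_zero⟩
  set d : ℚ := (-1 : ℚ) ^ (p / 2) * p with hd
  have hd0 : d ≠ 0 := Additive.pStar_ne_zero p
  have hC' : C⁻¹ • W = V.quadraticTwist d := by rw [← hC, inv_smul_smul]
  obtain ⟨e, hpos, hneg⟩ := exists_signEquiv_of_twist (W := V) (Wd := W) (p := p) hd0 C⁻¹ hC'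
  obtain ⟨X, hX, hXsub⟩ := hA
  set Q : geomTorsion V (p : ℤ) := e P with hQ
  have hQ0 : Q ≠ 0 := fun h ↦ hP0 (e.injective (h.trans (map_zero e).symm))
  have hsame : ∀ σ ∈ 𝔓.inertia (absoluteGaloisGroup ℚ), σ • geomSqrt d = geomSqrt d → σ • Q = Q := by
    intro σ hσ hs
    have h := hpos σ hs P
    rw [hfix σ hσ] at h
    exact h.symm
  have hflip : ∀ σ ∈ 𝔓.inertia (absoluteGaloisGroup ℚ), ¬ σ • geomSqrt d = geomSqrt d →
      σ • Q = -Q := by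
    intro σ hσ hs
    have h := hneg σ hs P
    rw [hfix σ hσ] at h
    have h' := congrArg Neg.neg h
    rw [neg_neg] at h'
    exact h'.symm
  have hvgen : Rat.HeightOneSpectrum.natGenerator v = p := Rat.natGenerator_eq_of_prime_mem v hp hv
  have hcop : Nat.Coprime 2 p := (Nat.coprime_primes Nat.prime_two hp).mpr (Ne.symm hp2)
  obtain ⟨τ, hτI, hτa⟩ := exists_mem_inertia_modNCyclotomicCharacter_eq (m := p) (p := p) (k := 0)
    (d := 1) (by rw [zero_add, pow_one, mul_one]) hp.not_dvd_one hvgen h𝔓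
    (a := ZMod.unitOfCoprime 2 hcop) (Subsingleton.elim _ _)
  have hval : ((((modPCyclotomicCharacterZMod ℚ p τ : (ZMod p)ˣ) : ZMod p).val : ℤ)) = 2 := by
    rw [modPCyclotomicCharacterZMod_eq_modNCyclotomicCharacter, hτa, ZMod.coe_unitOfCoprime,
      ZMod.val_natCast, Nat.mod_eq_of_lt (by omega)]
    norm_num
  have hγ : v.intValuation (((-1 : ℤ) ^ (p / 2) * p : ℤ) : 𝓞 ℚ) = WithZero.exp (-1 : ℤ) :=
    intValuation_pStar p hv
  have h2v : (2 : 𝓞 ℚ) ∉ v.asIdeal := two_not_mem_of_natCast_prime_mem hp hp2 hv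
  obtain ⟨σ₀, hσ₀I, hσ₀⟩ := exists_mem_inertia_smul_geomSqrt_eq_neg hγ h2v h𝔓
  have hcoe : ((((-1 : ℤ) ^ (p / 2) * p : ℤ) : 𝓞 ℚ) : ℚ) = d := by
    rw [RingOfIntegers.coe_eq_algebraMap, map_intCast, hd]
    push_cast
    rfl
  rw [hcoe] at hσ₀
  have hσ₀' : ¬ σ₀ • geomSqrt d = geomSqrt d := fun h ↦
    geomSqrt_ne_neg hd0 (h.symm.trans hσ₀)
  by_cases hQX : Q ∈ X
  · have hτQ := smul_eq_cyclotomic_zsmul_of_forall_sub_mem V p τ hX (hXsub τ hτI) hQX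
    rw [hval] at hτQ
    apply hQ0
    refine eq_zero_of_two_zsmul_eq_or hp3 ?_
    by_cases hs : τ • geomSqrt d = geomSqrt d
    · left; rw [← hτQ]; exact hsame τ hτI hs
    · right; rw [← hτQ]; exact hflip τ hτI hs
  · have hmem := hXsub σ₀ hσ₀I Q
    rw [hflip σ₀ hσ₀I hσ₀'] at hmem
    have h2 : (2 : ℤ) • Q ∈ X := by
      have heq : -Q - Q = -((2 : ℤ) • Q) := by rw [two_zsmul, neg_add, sub_eq_add_neg]
      rw [heq] at hmem
      exact (neg_mem_iff).mp hmem
    exact hQX (mem_of_zsmul_mem (two_intCast_zmod_ne_zero hp2) h2)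

/-- **X3♯(G-ord) / X4♯(G-ord) ∩ `I₀*` at `p ≥ 5`: `E[p]` has NO non-zero point fixed by an inertia
group above `p`** (type (G)-ordinary, additive, `semistabilityIndex W p = 2`, `p ≥ 5`; for every
place `v ∋ p` and every prime `𝔓 ∣ v` of `\bar ℤ`). Equivalently `E[p](K) = 0` for every algebraic
extension `K/ℚ` unramified at a prime above `p`. NO fact, NO datum. [cite: Serre1972, §1.11 Prop. 11 and Cor.]
[cite: SilvermanAEC2009, X.5 Cor. 5.4] -/
theorem TypeGOrd.eq_zero_of_forall_inertia_smul_eq [W.IsElliptic] [W.IsGloballyMinimal] (hG : TypeGOrd W p)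
    (hadd : Addv W p) (hp5 : 5 ≤ p) (he : semistabilityIndex W p = 2)
    {v : HeightOneSpectrum (𝓞 ℚ)} (hv : ((p : ℕ) : 𝓞 ℚ) ∈ v.asIdeal)
    {𝔓 : Ideal (absIntegers (𝓞 ℚ) ℚ)} (h𝔓 : 𝔓 ∈ v.primesAbove)
    {P : geomTorsion W (p : ℤ)} (hfix : ∀ σ ∈ 𝔓.inertia (absoluteGaloisGroup ℚ), σ • P = P) :
    P = 0 := by
  have hp2 : p ≠ 2 := by omega
  obtain ⟨V, _, _, C, hV, hC⟩ := TypeGOrd.exists_goodOrd_pStar_twist_model W p hp2 hG hadd he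
  exact eq_zero_of_forall_inertia_smul_eq_of_twist_model_of_unramifiedQuotientLineAt hp5 C hC hv h𝔓
    (unramifiedQuotientLineAt_of_goodOrdinary hp2 hV.1 hV.2 hv h𝔓) hfix

end Summit.BirchSwinnertonDyer.Rank1Residual.Additive.RationalLineTwist

end
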